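import Literature.AnabelianGeometry.AbsoluteAnabelian.AbsTopIThm26vCyclotomicInstance
import Literature.AnabelianGeometry.AbsoluteAnabelian.AbsTopIThm26iProofs
import Literature.AnabelianGeometry.AbsoluteAnabelian.FiniteFieldAbsoluteGaloisFreeProcyclic
import HarnessLib

/-!
# [AbsTopI] Thm 2.6 (i) AS TYPED (`FundamentalExtension.Thm26i`, FACT-LIST F-0246): the instance form
# PROVED at the cyclotomic extensions `1 → ℤ_ℓ(1) → ℤ_ℓ(1) ⋊_χ G_k → G_k → 1`, `k` a FINITE field

S. Mochizuki, *Topics in Absolute Anabelian Geometry I: Generalities*, J. Math. Sci. Univ. Tokyo 19 (2012)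
[MochizukiAbsTopI2012], Thm 2.6 (i), manuscript p. 21, proof p. 23 ll. 5–7:

  "The remainder of assertion (i) follows immediately from the fact that `T_l(A)/G = 0` [a consequence
   of the "Riemann hypothesis for abelian varieties over finite fields" — cf., e.g., [Mumf], p. 206]."

PROOF-ONLY companion (no definition, no instance, no named fact), abc-iut cell seat abc-iut-f-091 (gen 2);
finite-field twin of `AbsTopIThm26viCyclotomicInstance` ((vi), `k` an NF) and `AbsTopIThm26vCyclotomicInstance`
((v), `k` an MLF).  FACT-LIST row **F-0246** `FundamentalExtension.Thm26i` (abc-iut-f-090's tranche; its kernel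
witnesses so far: universal closure REFUTED, instance PROVED at the DEGENERATE point `Π = G = Gal(k̄/k)`,
`Δ = 1` — `exists_thm26i_absoluteGaloisGroup_finite`, `thm26i_holds`; "the curve case needs `π₁` of a curve
over a finite field").  Here, for EVERY finite field `k` and EVERY prime `ℓ` invertible in `k`, the extension

  `E_χ :  1 → ℤ_ℓ(1) → ℤ_ℓ(1) ⋊_χ G_k → G_k → 1`,   `χ = χ_ℓ : G_k → ℤ_ℓ^×` the `ℓ`-adic cyclotomic character

(the tree's continuous `GaloisRep.cyclotomicCharacter k ℓ`; topology along `g ↦ (g.left, g.right)`, generic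
`SettingModel.Semidirect` plumbing) — by Kummer theory (not constructed here: no étale `π₁` in the tree) the
geometrically pro-`ℓ` AFG-type extension of [AbsTopI] Def 2.1 (ii) with construction data
`(k, X, Y, Σ) = (k, 𝔾_m, 𝔾_m, {ℓ})`, `k` an FF, `ℓ` invertible in `k` — satisfies the typed (i):

* `G_k ≅ Ẑ` is free procyclic (the tree's `isFreeProcyclic_absoluteGaloisGroup_of_finite`, Serre *Local
  Fields* XIII §2);
* the Tate-module hypothesis `hT` of abc-iut-L4's conditional form `thm26i_of_isFreeProcyclic` (GAP-LEDGER
  G-L4t4-1: for EVERY open `H ⊆ Π` and every prime `l`, every `H`-invariant continuous character `Δ ∩ H → ℤ_l`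
  is trivial — the group-theoretic content of "`T_l(A_H)/G_H = 0`") HOLDS, NON-VACUOUSLY: `Δ ∩ H` is an
  `ℓ`-adic lattice, and `H` contains an element acting on it as the scalar `χ(h̄) ≠ 1` because the `ℓ`-adic
  cyclotomic character of a FINITE field is non-trivial on every open subgroup of `G_k` (the fixed field of
  an open subgroup is a FINITE field, which contains no primitive `ℓ^N`-th root of unity once `ℓ^N`
  exceeds its cardinality — `exists_mem_cyclotomicCharacter_ne_one_of_isOpen_of_finite`); then
  `ψ((χ(h̄) − 1)·x) = 0` and `ℤ_l` is torsion-free (`invariantCharacters_inf_trivial_of_conj_eq_mul`) —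
  this IS the printed "`T_ℓ(𝔾_m)/G = 0`" (Frobenius acts by `q ≠ 1`) at `X = 𝔾_m` and its coverings;
* hence **`E_χ.Thm26i` HOLDS**: `Π` is topologically finitely generated, `Δ = ℤ_ℓ(1)` is the common kernel
  of the continuous characters `Π → ℤ_l`, and `δ¹_l(H) = 1` for every open `H ⊆ Π` and every prime `l`.

Exactly as for (v)/(vi), the typed (i) is REFUTED at split models with `Δ ≠ 1` and trivial action
(`δ¹_l(F̂_n × Ẑ) = n + 1`), so a non-degenerate instance needs the non-trivial Galois action supplied here.
HONEST FRAMING: [AbsTopI] is a refereed, undisputed paper; the model is a group-theoretic construction whose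
identification with `π₁(𝔾_{m,k})^{(ℓ)}` is classical Kummer theory, NOT kernel-checked; nothing here bears on the
disputed [IUTchIII] Cor. 3.12 or takes a side on any author; typed ≠ proved elsewhere.
-/

noncomputable section

open Topology

universe u

namespace Literature.AnabelianGeometry.AbsoluteAnabelian

open Literature.NumberTheory.GaloisRepresentations
open Literature.AnabelianGeometry.EtaleTheta.SettingModel

/-! ## The `ℓ`-adic cyclotomic character of a finite field is non-trivial on every open subgroup -/

/-- **For a finite field `k`, a prime `ℓ` invertible in `k` and an OPEN subgroup `U ⊆ G_k`, the `ℓ`-adic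
cyclotomic character is non-trivial on `U`** (`k(μ_{ℓ^∞})/k` is infinite).  Proof: the fixed field `L` of `U`
is a finite extension of `k` (Krull correspondence, Mathlib `InfiniteGalois`), hence a FINITE field; if
`χ_ℓ|_U = 1`, a primitive `ℓ^N`-th root of unity `ζ ∈ k̄` (`N := #L`) is fixed by `U`, so lies in `L`, and
its `ℓ^N` distinct powers give `ℓ^N ≤ #L = N`, absurd. [cite: SerreLocalFields1979, Ch. XIII §2, Example a)] -/
theorem exists_mem_cyclotomicCharacter_ne_one_of_isOpen_of_finite (k : Type u) [Field k] [Finite k]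
    (ℓ : ℕ) [Fact ℓ.Prime] (hℓk : (ℓ : k) ≠ 0)
    (U : Subgroup (Field.absoluteGaloisGroup k)) (hU : IsOpen (U : Set (Field.absoluteGaloisGroup k))) :
    ∃ σ ∈ U, GaloisRep.cyclotomicCharacter k ℓ σ ≠ 1 := by
  classical
  haveI : IsGalois k (AlgebraicClosure k) := IsSepClosure.isGalois
  have hℓ : ℓ.Prime := Fact.out
  by_contra h
  push Not at h
  -- the fixed field of `U` is a finite extension of `k`, hence a finite field
  set L : IntermediateField k (AlgebraicClosure k) := IntermediateField.fixedField U with hLdef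
  have hLU : L.fixingSubgroup = U :=
    InfiniteGalois.fixingSubgroup_fixedField ⟨U, U.isClosed_of_isOpen hU⟩
  haveI : FiniteDimensional k L := by
    refine (InfiniteGalois.isOpen_iff_finite L).mp ?_
    change IsOpen (L.fixingSubgroup : Set (AlgebraicClosure k ≃ₐ[k] AlgebraicClosure k))
    rw [hLU]
    exact hU
  haveI : Finite L := Module.finite_of_finite k
  set N : ℕ := Nat.card L with hN
  -- a primitive `ℓ^N`-th root of unity of `k̄`
  haveI : NeZero (ℓ : k) := ⟨hℓk⟩
  have hℓK : (ℓ : AlgebraicClosure k) ≠ 0 := by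
    rw [← map_natCast (algebraMap k (AlgebraicClosure k))]
    exact (map_ne_zero (algebraMap k (AlgebraicClosure k))).mpr hℓk
  haveI : NeZero ((ℓ ^ N : ℕ) : AlgebraicClosure k) :=
    ⟨by exact_mod_cast pow_ne_zero N hℓK⟩
  obtain ⟨ζ, hζ⟩ := HasEnoughRootsOfUnity.exists_primitiveRoot (AlgebraicClosure k) (ℓ ^ N)
  have hN1 : 1 < ℓ ^ N := by
    have hNpos : 0 < N := by
      rw [hN]
      exact Nat.card_pos
    exact Nat.one_lt_pow hNpos.ne' hℓ.one_lt
  haveI : Fact (1 < ℓ ^ N) := ⟨hN1⟩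
  -- `U` fixes `ζ`, since `χ_ℓ|_U = 1`
  have hfix : ∀ σ : AlgebraicClosure k ≃ₐ[k] AlgebraicClosure k, σ ∈ U → σ ζ = ζ := by
    intro σ hσ
    have hspec :=
      GaloisRep.cyclotomicCharacter_spec k ℓ (k := N) (σ : Field.absoluteGaloisGroup k) ζ hζ.pow_eq_one
    rw [h σ hσ, Units.val_one, map_one, ZMod.val_one, pow_one] at hspec
    exact hspec
  have hmem : ζ ∈ L := by
    rw [hLdef, IntermediateField.mem_fixedField_iff]
    exact hfix
  -- the `ℓ^N` powers of `ζ` are distinct elements of `L`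
  let f : Fin (ℓ ^ N) → L := fun i => ⟨ζ, hmem⟩ ^ (i : ℕ)
  have hf : Function.Injective f := by
    intro i₁ i₂ h12
    apply Fin.ext
    have h' : ζ ^ (i₁ : ℕ) = ζ ^ (i₂ : ℕ) := by
      have := congrArg (fun y : L => (y : AlgebraicClosure k)) h12
      simpa only [f, SubmonoidClass.coe_pow] using this
    exact hζ.pow_inj i₁.2 i₂.2 h'
  have hle : ℓ ^ N ≤ N := by
    have := Nat.card_le_card_of_injective f hf
    rwa [Nat.card_eq_fintype_card, Fintype.card_fin] at this
  exact absurd hle (not_le.mpr (Nat.lt_pow_self hℓ.one_lt))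

namespace FundamentalExtension

/-! ## "`T_l(A_H)/G_H = 0`" at a rank-one geometric group, for every open `H ⊆ Π` -/

/-- **The mechanism behind [AbsTopI] Thm 2.6 (i)'s "`T_l(A)/G = 0`" for the open subgroups `H ⊆ Π`.**  Let
`1 → Δ → Π → G → 1` be ANY extension with `Δ` the image of a continuous `j : ℤ_{ℓ'} → Π`, `H ⊆ Π` open, and
suppose some `π ∈ H` acts on `Δ` as multiplication by an `ℓ'`-adic integer `c ≠ 1`.  Then for every prime `l`,
every `H`-invariant continuous character `ψ : Δ ∩ H → ℤ_l` is trivial: on the `ℓ'`-adic lattice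
`S = j⁻¹(H)` the map `F := ψ ∘ j` is additive with `F((c − 1)·s) = 0`; writing `c − 1 = u·ℓ'^k` gives
`ℓ'^k · F(s) = F((c−1)·u⁻¹s) = 0`, and `ℤ_l` is torsion-free.  (The shape of the hypothesis `hT` of
`thm26i_of_isFreeProcyclic`.) [cite: MochizukiAbsTopI2012, Thm 2.6 (i) p.21] -/
theorem invariantCharacters_inf_trivial_of_conj_eq_mul (E : FundamentalExtension.{u}) {ℓ' : ℕ}
    [Fact ℓ'.Prime] (j : Multiplicative ℤ_[ℓ'] →ₜ* E.arith) (hj : j.toMonoidHom.range = E.geom)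
    (H : Subgroup E.arith) (hH : IsOpen (H : Set E.arith)) (π : E.arith) (hπ : π ∈ H)
    (c : ℤ_[ℓ']) (hc : c ≠ 1)
    (hconj : ∀ a : ℤ_[ℓ'],
      π * j (Multiplicative.ofAdd a) * π⁻¹ = j (Multiplicative.ofAdd (c * a)))
    (l : ℕ) [Fact l.Prime] (ψ : ↥(E.geom ⊓ H) →ₜ* Multiplicative ℤ_[l])
    (hψ : ∀ g ∈ H, ∀ (d d' : ↥(E.geom ⊓ H)), (d' : E.arith) = g * d * g⁻¹ → ψ d' = ψ d)
    (d : ↥(E.geom ⊓ H)) : ψ d = 1 := by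
  have hℓ' : ℓ'.Prime := Fact.out
  have hmem : ∀ a : ℤ_[ℓ'], j (Multiplicative.ofAdd a) ∈ E.geom := fun a => hj ▸ ⟨_, rfl⟩
  -- the lattice `S = j⁻¹(H) ⊆ ℤ_{ℓ'}` (multiplicative and additive avatars)
  let S : Subgroup (Multiplicative ℤ_[ℓ']) := H.comap j.toMonoidHom
  have hS : IsClosed (S : Set (Multiplicative ℤ_[ℓ'])) :=
    (H.isClosed_of_isOpen hH).preimage (map_continuous j)
  let S' : AddSubgroup ℤ_[ℓ'] := AddSubgroup.toSubgroup.symm S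
  have hS'mem : ∀ {a : ℤ_[ℓ']}, a ∈ S' ↔ j (Multiplicative.ofAdd a) ∈ H := fun {a} => Iff.rfl
  have hscale : ∀ (t : ℤ_[ℓ']) {a : ℤ_[ℓ']}, a ∈ S' → t * a ∈ S' := fun t {a} ha =>
    hS'mem.mpr (ofAdd_mul_mem_of_isClosed S hS (hS'mem.mp ha) t)
  -- the element of `Δ ∩ H` attached to `a ∈ S'`
  let e : ↥S' → ↥(E.geom ⊓ H) := fun s =>
    ⟨j (Multiplicative.ofAdd (s : ℤ_[ℓ'])), Subgroup.mem_inf.mpr ⟨hmem _, hS'mem.mp s.2⟩⟩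
  have he_add : ∀ s t : ↥S', e (s + t) = e s * e t := by
    intro s t
    apply Subtype.ext
    change j (Multiplicative.ofAdd ((s : ℤ_[ℓ']) + t)) =
      j (Multiplicative.ofAdd (s : ℤ_[ℓ'])) * j (Multiplicative.ofAdd (t : ℤ_[ℓ']))
    rw [ofAdd_add, map_mul]
  -- the additive character `F := ψ ∘ j` on `S'`
  let F : ↥S' →+ ℤ_[l] := AddMonoidHom.mk' (fun s => Multiplicative.toAdd (ψ (e s))) (by
    intro s t
    change Multiplicative.toAdd (ψ (e (s + t))) = _
    rw [he_add, map_mul, toAdd_mul])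
  have hF : ∀ s : ↥S', F s = Multiplicative.toAdd (ψ (e s)) := fun s => rfl
  -- invariance under `π`: `F (c • s) = F s`
  have hinv : ∀ s : ↥S', F ⟨c * s, hscale c s.2⟩ = F s := by
    intro s
    rw [hF, hF]
    congr 1
    refine hψ π hπ (e s) (e ⟨c * s, hscale c s.2⟩) ?_
    exact (hconj s).symm
  -- hence `F ((c - 1) • s) = 0`
  have hkill : ∀ s : ↥S', F ⟨(c - 1) * s, hscale (c - 1) s.2⟩ = 0 := by
    intro s
    have hsplit : (⟨(c - 1) * s, hscale (c - 1) s.2⟩ : ↥S') = ⟨c * s, hscale c s.2⟩ - s := by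
      apply Subtype.ext
      change (c - 1) * (s : ℤ_[ℓ']) = c * s - s
      ring
    rw [hsplit, map_sub, hinv, sub_self]
  -- `c - 1 = v * ℓ'^k`, `v` a unit
  have hc1 : c - 1 ≠ 0 := sub_ne_zero.mpr hc
  set k := (c - 1).valuation
  set v : ℤ_[ℓ']ˣ := PadicInt.unitCoeff hc1
  have hspec : c - 1 = (v : ℤ_[ℓ']) * (ℓ' : ℤ_[ℓ']) ^ k := PadicInt.unitCoeff_spec hc1
  -- so `ℓ'^k • F s = 0`, and `ℤ_l` is torsion-free
  have hzero : ∀ s : ↥S', F s = 0 := by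
    intro s
    have hs'' : ((v⁻¹ : ℤ_[ℓ']ˣ) : ℤ_[ℓ']) * s ∈ S' := hscale _ s.2
    have h0 := hkill ⟨_, hs''⟩
    have hre : (⟨(c - 1) * ((((v⁻¹ : ℤ_[ℓ']ˣ) : ℤ_[ℓ'])) * s), hscale (c - 1) hs''⟩ : ↥S') =
        (ℓ' ^ k : ℕ) • s := by
      apply Subtype.ext
      change (c - 1) * ((((v⁻¹ : ℤ_[ℓ']ˣ) : ℤ_[ℓ'])) * s) = ((ℓ' ^ k : ℕ) • s : ↥S')
      rw [AddSubgroupClass.coe_nsmul, nsmul_eq_mul, Nat.cast_pow, hspec, mul_comm (v : ℤ_[ℓ']) _,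
        mul_assoc, ← mul_assoc (v : ℤ_[ℓ']), Units.mul_inv, one_mul]
    rw [hre, map_nsmul, nsmul_eq_mul] at h0
    have hne : ((ℓ' ^ k : ℕ) : ℤ_[l]) ≠ 0 := Nat.cast_ne_zero.mpr (pow_ne_zero k hℓ'.ne_zero)
    exact (mul_eq_zero.mp h0).resolve_left hne
  -- every `d ∈ Δ ∩ H` is `e s` for some `s`
  obtain ⟨hdΔ, hdH⟩ := Subgroup.mem_inf.mp d.2
  have hdr : (d : E.arith) ∈ j.toMonoidHom.range := by
    rw [hj]
    exact hdΔ
  obtain ⟨m, hm⟩ := hdr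
  have hm' : j m = (d : E.arith) := hm
  have hmS : Multiplicative.toAdd m ∈ S' := by
    rw [hS'mem, ofAdd_toAdd, hm']
    exact hdH
  have hd : d = e ⟨Multiplicative.toAdd m, hmS⟩ := by
    apply Subtype.ext
    change (d : E.arith) = j (Multiplicative.ofAdd (Multiplicative.toAdd m))
    rw [ofAdd_toAdd]
    exact hm'.symm
  have h1 := hzero ⟨Multiplicative.toAdd m, hmS⟩
  rw [hF, toAdd_eq_zero] at h1
  rw [hd]
  exact h1

/-! ## The cyclotomic extensions `1 → ℤ_ℓ(1) → ℤ_ℓ(1) ⋊_χ G_k → G_k → 1`, `k` a finite field -/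

/-- **FACT-LIST F-0246: [AbsTopI] Thm 2.6 (i) AS TYPED holds at the cyclotomic extension
`1 → ℤ_ℓ(1) → ℤ_ℓ(1) ⋊_χ G_k → G_k → 1`** — the group-theoretic model of the geometrically pro-`ℓ` AFG-type
extension of `X = 𝔾_m` over the FINITE field `k` ([AbsTopI] Def 2.1 (ii), construction data
`(k, 𝔾_m, 𝔾_m, {ℓ})`, up to the Kummer identification `π₁(𝔾_{m,k̄})^{(ℓ)} = ℤ_ℓ(1)`, not constructed here), for
every finite field `k` and every prime `ℓ` invertible in `k`.  Recorded as an existential over the tree's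
vocabulary: there are an extension `E`, an identification `i : G ≅ G_k` and a continuous embedding
`j : ℤ_ℓ ↪ Π` with image `Δ` such that (a) `Π` acts on `Δ = j(ℤ_ℓ)` through the `ℓ`-adic cyclotomic
character of `G_k` composed with the augmentation ("`Δ = ℤ_ℓ(1)`", Frobenius acting by `#k`); (b) `E` splits,
`Δ` is topologically finitely generated and `Δ ≠ 1`; (c) the Tate-module hypothesis of
`thm26i_of_isFreeProcyclic` HOLDS for EVERY open `H ⊆ Π` and every prime `l`; (d) `E.Thm26i` HOLDS: `Π`
topologically finitely generated, `Δ` = the common kernel of the continuous `Π → ℤ_l`, `δ¹_l(H) = 1` for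
every open `H` and every `l`.  Inputs by name: `GaloisRep.cyclotomicCharacter k ℓ`,
`isFreeProcyclic_absoluteGaloisGroup_of_finite` (`G_k ≅ Ẑ`), `thm26i_of_isFreeProcyclic`,
`SettingModel.Semidirect.*`. [cite: MochizukiAbsTopI2012, Thm 2.6 (i) p.21] -/
theorem exists_cyclotomicModel_thm26i (k : Type) [Field k] [Finite k] (ℓ : ℕ) [Fact ℓ.Prime]
    (hℓk : (ℓ : k) ≠ 0) :
    ∃ (E : FundamentalExtension.{0}) (i : E.gal ≃ₜ* Field.absoluteGaloisGroup k)
      (j : Multiplicative ℤ_[ℓ] →ₜ* E.arith),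
      Function.Injective j ∧ j.toMonoidHom.range = E.geom ∧
      (∀ (g : E.arith) (a : ℤ_[ℓ]), g * j (Multiplicative.ofAdd a) * g⁻¹ =
        j (Multiplicative.ofAdd
          (((GaloisRep.cyclotomicCharacter k ℓ (i (E.aug g)) : ℤ_[ℓ]ˣ) : ℤ_[ℓ]) * a))) ∧
      E.SplitsOverOpenSubgroup ∧ E.GeomTFG ∧ E.geom ≠ ⊥ ∧
      (∀ (H : Subgroup E.arith), IsOpen (H : Set E.arith) → ∀ (l : ℕ) [Fact l.Prime]
        (ψ : ↥(E.geom ⊓ H) →ₜ* Multiplicative ℤ_[l]),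
        (∀ g ∈ H, ∀ (d d' : ↥(E.geom ⊓ H)), (d' : E.arith) = g * d * g⁻¹ → ψ d' = ψ d) →
          ∀ d, ψ d = 1) ∧
      E.Thm26i := by
  classical
  haveI : IsGalois k (AlgebraicClosure k) := IsSepClosure.isGalois
  haveI : CompactSpace (Field.absoluteGaloisGroup k) :=
    inferInstanceAs <| CompactSpace (AlgebraicClosure k ≃ₐ[k] AlgebraicClosure k)
  let Z : Type := Multiplicative ℤ_[ℓ]
  let Γ : Type := Field.absoluteGaloisGroup k
  let χ : Γ →ₜ* ℤ_[ℓ]ˣ := GaloisRep.cyclotomicCharacter k ℓ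
  -- the action of `G_k` on `ℤ_ℓ(1)`: `σ ↦ (x ↦ χ(σ) • x)`
  let φ : Γ →* MulAut Z :=
    ((MulAutMultiplicative ℤ_[ℓ]).symm.toMonoidHom.comp AddAut.mulLeft).comp χ.toMonoidHom
  have hφ : ∀ (σ : Γ) (x : Z),
      φ σ x = Multiplicative.ofAdd (((χ σ : ℤ_[ℓ]ˣ) : ℤ_[ℓ]) * Multiplicative.toAdd x) := fun _ _ => rfl
  -- the topology of `ℤ_ℓ(1) ⋊_χ G_k`: induced along `g ↦ (g.left, g.right)`
  letI τ : TopologicalSpace (Z ⋊[φ] Γ) :=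
    TopologicalSpace.induced (fun g : Z ⋊[φ] Γ => (g.left, g.right)) inferInstance
  have hι : IsInducing fun g : Z ⋊[φ] Γ => (g.left, g.right) := ⟨rfl⟩
  have hact : Continuous fun q : Γ × Z => φ q.1 q.2 := by
    have heq : (fun q : Γ × Z => φ q.1 q.2) = fun q =>
        Multiplicative.ofAdd (((χ q.1 : ℤ_[ℓ]ˣ) : ℤ_[ℓ]) * Multiplicative.toAdd q.2) :=
      funext fun q => hφ q.1 q.2
    rw [heq]
    exact continuous_ofAdd.comp
      ((Units.continuous_val.comp ((map_continuous χ).comp continuous_fst)).mul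
        (continuous_toAdd.comp continuous_snd))
  haveI : IsTopologicalGroup (Z ⋊[φ] Γ) := Semidirect.isTopologicalGroup_of_continuous_action hι hact
  haveI : CompactSpace (Z ⋊[φ] Γ) := Semidirect.compactSpace_of hι
  haveI : TotallyDisconnectedSpace (Z ⋊[φ] Γ) := Semidirect.totallyDisconnectedSpace_of hι
  -- the extension
  let E : FundamentalExtension.{0} :=
    { arith := ProfiniteGrp.of (Z ⋊[φ] Γ)
      gal := ProfiniteGrp.of Γ
      aug := Semidirect.rightHomCont hι
      aug_surjective := SemidirectProduct.rightHom_surjective }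
  let i : E.gal ≃ₜ* Γ := ContinuousMulEquiv.refl _
  let j : Z →ₜ* E.arith := ⟨SemidirectProduct.inl, Semidirect.continuous_inl hι⟩
  -- `Δ = ker(right) = inl(ℤ_ℓ)`
  have hmem_iff : ∀ g : E.arith, g ∈ E.geom ↔ (g : Z ⋊[φ] Γ).right = 1 := fun g => E.mem_geom
  have hrange : j.toMonoidHom.range = E.geom := by
    ext g
    rw [hmem_iff]
    constructor
    · rintro ⟨x, rfl⟩
      rfl
    · intro hg
      refine ⟨(g : Z ⋊[φ] Γ).left, ?_⟩
      change SemidirectProduct.inl _ = g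
      conv_rhs => rw [← SemidirectProduct.inl_left_mul_inr_right (g : Z ⋊[φ] Γ)]
      rw [hg, map_one, mul_one]
  have hinj : Function.Injective j := SemidirectProduct.inl_injective
  -- conjugation inside `ℤ_ℓ ⋊_φ G_k`: `(n,σ) · x · (n,σ)⁻¹ = φ σ x` (`ℤ_ℓ` is commutative)
  have key : ∀ (n x : Z) (σ : Γ),
      (SemidirectProduct.inl n * SemidirectProduct.inr σ : Z ⋊[φ] Γ) * SemidirectProduct.inl x *
        (SemidirectProduct.inl n * SemidirectProduct.inr σ)⁻¹ = SemidirectProduct.inl (φ σ x) := by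
    intro n x σ
    calc (SemidirectProduct.inl n * SemidirectProduct.inr σ : Z ⋊[φ] Γ) * SemidirectProduct.inl x *
          (SemidirectProduct.inl n * SemidirectProduct.inr σ)⁻¹
        = SemidirectProduct.inl n *
            (SemidirectProduct.inr σ * SemidirectProduct.inl x * SemidirectProduct.inr σ⁻¹) *
            (SemidirectProduct.inl n)⁻¹ := by
          rw [map_inv, mul_inv_rev]
          simp only [mul_assoc]
      _ = SemidirectProduct.inl (n * φ σ x * n⁻¹) := by
          rw [← SemidirectProduct.inl_aut, map_mul, map_mul, map_inv]
      _ = SemidirectProduct.inl (φ σ x) := by rw [mul_comm n, mul_inv_cancel_right]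
  -- (a) `Π` acts on `Δ` through `χ ∘ aug`
  have hconj : ∀ (g : E.arith) (a : ℤ_[ℓ]), g * j (Multiplicative.ofAdd a) * g⁻¹ =
      j (Multiplicative.ofAdd (((GaloisRep.cyclotomicCharacter k ℓ (i (E.aug g)) : ℤ_[ℓ]ˣ) : ℤ_[ℓ]) * a)) := by
    intro g a
    change (g : Z ⋊[φ] Γ) * SemidirectProduct.inl (Multiplicative.ofAdd a) * g⁻¹ =
      SemidirectProduct.inl (Multiplicative.ofAdd (((χ (g : Z ⋊[φ] Γ).right : ℤ_[ℓ]ˣ) : ℤ_[ℓ]) * a))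
    have h1 : (SemidirectProduct.inl
        (Multiplicative.ofAdd (((χ (g : Z ⋊[φ] Γ).right : ℤ_[ℓ]ˣ) : ℤ_[ℓ]) * a)) : Z ⋊[φ] Γ) =
        SemidirectProduct.inl (φ (g : Z ⋊[φ] Γ).right (Multiplicative.ofAdd a)) := by
      rw [hφ]
      rfl
    rw [h1, ← key (g : Z ⋊[φ] Γ).left (Multiplicative.ofAdd a) (g : Z ⋊[φ] Γ).right,
      SemidirectProduct.inl_left_mul_inr_right]
  -- (b) the extension splits: `σ ↦ (0, σ)` is a continuous section over all of `G_k`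
  have hsplit : E.SplitsOverOpenSubgroup := by
    refine ⟨⊤, (⟨SemidirectProduct.inr, Semidirect.continuous_inr hι⟩ : Γ →ₜ* (Z ⋊[φ] Γ)).comp
      ⟨(⊤ : Subgroup Γ).subtype, continuous_subtype_val⟩, ?_, fun u => rfl⟩
    rw [Subgroup.coe_top]
    exact isOpen_univ
  -- `Δ ≅ ℤ_ℓ` is topologically finitely generated ([AbsTopI] Prop 2.2 at the model)
  have htfg : E.GeomTFG := by
    let jΔ : Z →ₜ* E.geom :=
      ⟨(SemidirectProduct.inl : Z →* Z ⋊[φ] Γ).codRestrict E.geom (fun z => (hmem_iff _).mpr rfl),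
        (Semidirect.continuous_inl hι).subtype_mk _⟩
    have hjΔ : Function.Surjective jΔ := by
      rintro ⟨g, hg⟩
      refine ⟨(g : Z ⋊[φ] Γ).left, Subtype.ext ?_⟩
      change SemidirectProduct.inl _ = g
      conv_rhs => rw [← SemidirectProduct.inl_left_mul_inr_right (g : Z ⋊[φ] Γ)]
      rw [(hmem_iff g).mp hg, map_one, mul_one]
    exact (isTopologicallyFinitelyGenerated_multiplicative_padicInt ℓ).of_surjective jΔ hjΔ
  -- `Δ ≠ 1`
  have hne : E.geom ≠ ⊥ := by
    intro h
    have h1 : j (Multiplicative.ofAdd (1 : ℤ_[ℓ])) ∈ E.geom := hrange ▸ ⟨_, rfl⟩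
    rw [h, Subgroup.mem_bot] at h1
    have h2 : Multiplicative.ofAdd (1 : ℤ_[ℓ]) = 1 := hinj (by rw [h1, map_one])
    exact one_ne_zero (ofAdd_eq_one.mp h2)
  -- (c) the Tate-module hypothesis for every open `H`: `H` maps onto an open subgroup of `G_k`, on which
  -- `χ_ℓ` is non-trivial; such an element of `H` acts on `Δ` by a scalar `≠ 1`
  have hT : ∀ (H : Subgroup E.arith), IsOpen (H : Set E.arith) → ∀ (l : ℕ) [Fact l.Prime]
      (ψ : ↥(E.geom ⊓ H) →ₜ* Multiplicative ℤ_[l]),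
      (∀ g ∈ H, ∀ (d d' : ↥(E.geom ⊓ H)), (d' : E.arith) = g * d * g⁻¹ → ψ d' = ψ d) →
        ∀ d, ψ d = 1 := by
    intro H hH l _ ψ hψ d
    have hHo : IsOpen ((H.map E.aug.toMonoidHom : Subgroup E.gal) : Set E.gal) := by
      rw [Subgroup.coe_map]
      exact Semidirect.isOpenMap_right hι _ hH
    obtain ⟨σ, hσH, hσ⟩ :=
      exists_mem_cyclotomicCharacter_ne_one_of_isOpen_of_finite k ℓ hℓk (H.map E.aug.toMonoidHom) hHo
    obtain ⟨π, hπH, hπσ⟩ := Subgroup.mem_map.mp hσH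
    refine E.invariantCharacters_inf_trivial_of_conj_eq_mul j hrange H hH π hπH
      ((χ σ : ℤ_[ℓ]ˣ) : ℤ_[ℓ]) (fun h => hσ (Units.val_eq_one.mp h)) (fun a => ?_) l ψ hψ d
    have h := hconj π a
    have hr : i (E.aug π) = σ := hπσ
    rw [hr] at h
    exact h
  refine ⟨E, i, j, hinj, hrange, hconj, hsplit, htfg, hne, hT, ?_⟩
  -- (d) Thm 2.6 (i) AS TYPED, via abc-iut-L4's conditional form (`G_k ≅ Ẑ` free procyclic, in tree)
  exact E.thm26i_of_isFreeProcyclic (isFreeProcyclic_absoluteGaloisGroup_of_finite k) htfg hT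

end FundamentalExtension

end Literature.AnabelianGeometry.AbsoluteAnabelian

end
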